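import Literature.AlgebraicGeometry.Resolution.HenselizedRationalValues
import Literature.AlgebraicGeometry.Resolution.PthRootsOfOneUnits
import HarnessLib

/-!
# Kummer radicands `1 + b` over `K(x)^h` in mixed characteristic: elimination of `p`-th powers (Kuhlmann 2010, Prop. 4.6, proof)

Topic: `Literature/AlgebraicGeometry/Resolution` (valued function fields). The computational
heart of F.-V. Kuhlmann, *Elimination of ramification I: The generalized stability theorem*,
Trans. AMS 362 (2010) 5697–5727 = arXiv:1003.5678, §4.1, **Prop. 4.6** (the
mixed-characteristic, value-transcendental case of Prop. 4.1) — the last named fact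
`Kuhlmann2010Prop46ValueIndex` (`NormalDegreePDefectlessVTGalois.lean`) below the italicized
statement of §5 for `K(x)^h`. For a Kummer generator `ϑ`, `ϑ^p = 1 + b` a `1`-unit of
`F = K(x)^h` (`K` algebraically closed, `x` value-transcendental, `F` of rank one, `char K = 0`,
`char K̄ = p`), the source transforms the radicand inside `(1+b)·(F^×)^p`:

> By Lemma 4.4 and part a) of Corollary 2.11, we may assume that `u = 1 + ∑_{i∈I} cᵢxⁱ ∈ R` …
> In a first step, we will eliminate all `p`-th powers `≠ c₀` of value `≤ vp` in the above sum
> … Using (11), we replace `u` by `u' := u/(1+∑ z_j)^{p^ν}` … modulo `p𝓜_F` … Since `K` is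
> closed under `p`-th roots, `1+c₀` is a `p`-th power in `K`. We may thus replace `u` by
> `u/(1+c₀)` … part d) of Corollary 2.11 shows that we may replace every monomial of the form
> `cᵢxⁱ` with `i ∈ pℤ` by the monomial `-p c̃ᵢ x^{i/p}` where `c̃ᵢ ∈ K` is a `p`-th root of `cᵢ`
> … After an iterated application we may then assume in addition that `I ∩ pℤ = ∅`. … Hence
> there is some `j ∈ I` such that `v∑_{i∈I} cᵢxⁱ = vc_jx^j`. We have that `j ∉ pℤ`.

## Content (everything PROVED)

Ambient rendering as in `HenselizedRationalArtinSchreier.lean`: one algebraically closed valued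
field `(Ω, V)`, `K ≤ Ω` an algebraically closed subfield, `x` value-transcendental over `K`,
`F = henselizedAdjoin V K x` of rank one, `C ∈ K` with `C^{p-1} = -p` (`PthRootsOfOneUnits.lean`),
`p ≠ 0` in `Ω`, `v(p) < 1`; finite Laurent series are `c.sum fun i a => a·xⁱ`, `c : ℤ →₀ K`.
A radicand `b` is GOOD if `v(b) = v(c x^j)` with `c ∈ K^×` and `p ∤ j` — the source's end
state "`v∑cᵢxⁱ = vc_jx^j`, `j ∉ pℤ`", from which `(vE:vF) = p` follows (next file).

* `exists_one_add_sum_pow_prime_eq` — `(1 + ∑ zᵢ)^p = 1 + ∑ zᵢ^p + e` with `v(e) < v(p)` for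
  `v(zᵢ) < 1` (the congruences "modulo `p𝓜_F`" of the first elimination step).
* `valuation_sub_one_pow_eq` — for `ϑ^p = 1 + b` with `v(C)^p < v(b) < 1`:
  `v(ϑ - 1)^p = v(b)` (the final value computation of the proof, "`pvϑ = vb/C^p` …
  `vη = (1/p)vbC^{-p}`", in the variable `ϑ - 1 = Cη`).
* `valuation_C_pow_lt_of_good` — a GOOD radicand which is not a `p`-th power has level below
  `(p/(p-1))vp` (Lemma 2.10).
* `exists_laurent_radicand` — a radicand of level `> vp` may be taken to be a finite Laurent
  series without constant term, all of whose monomials have level `> vp` (Lemma 4.4,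
  Cor. 2.11 a), "`1 + c₀` is a `p`-th power in `K`").
* `exists_good_radicand_of_laurent` — **the cascade** "replace `cᵢxⁱ`, `i ∈ pℤ`, by
  `-p c̃ᵢ x^{i/p}` (Cor. 2.11 d)) … until `I ∩ pℤ = ∅`", by induction on `∑_{i∈I} ν_p(i)`; the
  end state is GOOD (or `I = ∅`, excluded because `ϑ ∉ F`).

The first elimination step (division by `(1 + ∑_{p∣i} cᵢ^{1/p} x^{i/p})^p`, which produces a
GOOD radicand or one of level `> vp`) and the resulting `exists_good_radicand` are in
`KummerRadicandsVT.lean`; the value index `(vE:vF) = p` in `NormalDegreePDefectlessVTGaloisProofs.lean`.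

## Sources

* F.-V. Kuhlmann, *Elimination of ramification I: The generalized stability theorem*, Trans.
  Amer. Math. Soc. 362 (2010) 5697–5727 = arXiv:1003.5678: §2.2 (Lemma 2.10, Cor. 2.11),
  §4.1 (Lemma 4.4, Prop. 4.6 and its proof, pp. 12–13). [Kuhlmann2010]

## Rendering notes

* The source first normalises ALL `p`-th-power monomials of value `≤ vp` by a descending
  induction on the level `ν` of `p^ν`-th powers, computing modulo `p𝓜_F`; here one division by
  `(1 + ∑_{p∣i} cᵢ^{1/p}x^{i/p})^p` is performed and its outcome is sorted by value: either the
  monomials with `i ∉ pℤ` already dominate (GOOD), or the new radicand has level `> vp`, where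
  the source's exact cascade of Cor. 2.11 d) applies verbatim. Only the value index is the goal
  (`Kuhlmann2010Prop46ValueIndex` vendors "In both cases, `(vE:vF) = p`"), so the finer printed
  normal form (the bounds `vcᵢxⁱ ≤ (p/(p-1))vp`, `I ⊂ ℤ ∖ pℤ`) is not recorded as such.
-/

noncomputable section

open IsLocalRing

namespace Literature.AlgebraicGeometry.Resolution

universe u

variable {Ω : Type u} [Field Ω] (V : ValuationSubring Ω)

/-! ### Generic valuation lemmas -/

section Generic

/-- `v(p) < 1` when the residue field has characteristic `p`. [folklore] -/
theorem valuation_natCast_lt_one_of_charP (p : ℕ) [CharP (ResidueField V) p] :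
    V.valuation (p : Ω) < 1 := by
  have h : residue V (p : V) = 0 := by
    rw [map_natCast, CharP.cast_eq_zero]
  rw [residue_eq_zero_iff] at h
  have := (V.valuation_lt_one_iff (p : V)).mp h
  simpa using this

/-- **Freshman's dream with error term** (the congruences modulo `p𝓜_F` in the proof of
Prop. 4.6: "`(1+∑ z_j)^{p}` … is equivalent to `1 + ∑ z_j^p` modulo `p𝓜_F`"): for elements `zᵢ` of a
subfield `F` with `v(zᵢ) < 1`, `(1 + ∑ zᵢ)^p = 1 + ∑ zᵢ^p + e` with `e ∈ F` and `v(e) < v(p)`.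
PROVED by induction from Mathlib's `add_pow_prime_eq`
(`(a+z)^p = a^p + z^p + p·a·z·(…)`). [cite: Kuhlmann2010, Section 4.1, proof of Prop. 4.6] -/
theorem exists_one_add_sum_pow_prime_eq {F : Subfield Ω} {p : ℕ} (hp : p.Prime)
    (hp0 : (p : Ω) ≠ 0) {ι : Type*} (s : Finset ι) (z : ι → Ω) (hzF : ∀ i ∈ s, z i ∈ F)
    (hz : ∀ i ∈ s, V.valuation (z i) < 1) :
    ∃ e ∈ F, V.valuation e < V.valuation (p : Ω) ∧
      (1 + ∑ i ∈ s, z i) ^ p = 1 + ∑ i ∈ s, z i ^ p + e := by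
  classical
  have hvp : 0 < V.valuation (p : Ω) := (Valuation.pos_iff _).mpr hp0
  have hnatV : ∀ n : ℕ, V.valuation (n : Ω) ≤ 1 := fun n =>
    (V.valuation_le_one_iff _).mpr (natCast_mem V n)
  induction s using Finset.induction_on with
  | empty =>
    refine ⟨0, F.zero_mem, by rw [map_zero]; exact hvp, ?_⟩
    simp
  | insert i s hi ih =>
    obtain ⟨e, heF, he, heq⟩ := ih (fun j hj => hzF j (Finset.mem_insert_of_mem hj))
      (fun j hj => hz j (Finset.mem_insert_of_mem hj))
    have hzi : V.valuation (z i) < 1 := hz i (Finset.mem_insert_self i s)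
    have hziF : z i ∈ F := hzF i (Finset.mem_insert_self i s)
    set a : Ω := 1 + ∑ j ∈ s, z j with ha
    have haF : a ∈ F := add_mem F.one_mem (sum_mem fun j hj => hzF j (Finset.mem_insert_of_mem hj))
    have ha1 : V.valuation a ≤ 1 := by
      refine Valuation.map_add_le _ (le_of_eq (map_one _)) (Valuation.map_sum_le _ fun j hj => ?_)
      exact (hz j (Finset.mem_insert_of_mem hj)).le
    -- the binomial expansion
    set S : Ω := ∑ k ∈ Finset.Ioo 0 p,
      a ^ (k - 1) * z i ^ (p - k - 1) * ((p.choose k / p : ℕ) : Ω) with hS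
    have hexp : (a + z i) ^ p = a ^ p + z i ^ p + p * a * z i * S := add_pow_prime_eq hp a (z i)
    have hSF : S ∈ F := sum_mem fun k _ =>
      mul_mem (mul_mem (pow_mem haF _) (pow_mem hziF _)) (natCast_mem F _)
    have hS1 : V.valuation S ≤ 1 := by
      refine Valuation.map_sum_le _ fun k _ => ?_
      rw [map_mul, map_mul, map_pow, map_pow]
      exact mul_le_one' (mul_le_one' (pow_le_one₀ zero_le ha1) (pow_le_one₀ zero_le hzi.le))
        (hnatV _)
    refine ⟨e + p * a * z i * S, add_mem heF (mul_mem (mul_mem (mul_mem (natCast_mem F p) haF)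
      hziF) hSF), ?_, ?_⟩
    · refine Valuation.map_add_lt _ he ?_
      rw [map_mul, map_mul, map_mul, mul_assoc, mul_assoc]
      calc V.valuation (p : Ω) * (V.valuation a * (V.valuation (z i) * V.valuation S))
          < V.valuation (p : Ω) * 1 := by
            refine mul_lt_mul_of_pos_left ?_ hvp
            calc V.valuation a * (V.valuation (z i) * V.valuation S)
                ≤ 1 * (V.valuation (z i) * 1) :=
                  mul_le_mul' ha1 (mul_le_mul_right hS1 _)
              _ = V.valuation (z i) := by rw [one_mul, mul_one]
              _ < 1 := hzi
        _ = V.valuation (p : Ω) := mul_one _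
    · rw [Finset.sum_insert hi, Finset.sum_insert hi,
        show (1 : Ω) + (z i + ∑ j ∈ s, z j) = a + z i by rw [ha]; ring, hexp, heq]
      ring

/-- **A Kummer generator is not rescaled into the base**: if `K ≤ F` with `K` algebraically
closed, `ϑ ∉ F` and `w ∈ F`, then `w^p ≠ ϑ^p` for `p ≠ 0` (`ϑ/w` would be a `p`-th root of unity,
hence in `K`). [folklore] -/
theorem pow_ne_pow_of_not_mem {K F : Subfield Ω} (hK : IsAlgClosed K) (hKF : K ≤ F) {p : ℕ}
    (hp : p ≠ 0) {ϑ w : Ω} (hϑF : ϑ ∉ F) (hwF : w ∈ F) : w ^ p ≠ ϑ ^ p := by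
  intro h
  have hw0 : w ≠ 0 := by
    rintro rfl
    rw [zero_pow hp, eq_comm] at h
    exact hϑF (by rw [pow_eq_zero_iff hp |>.mp h]; exact F.zero_mem)
  have hroot : (ϑ / w) ^ p = 1 := by rw [div_pow, ← h, div_self (pow_ne_zero _ hw0)]
  have hmem : ϑ / w ∈ F := hKF (mem_of_pow_eq_one_of_isAlgClosed hK hp hroot)
  exact hϑF (by rw [← div_mul_cancel₀ ϑ hw0]; exact mul_mem hmem hwF)

/-- `ϑ ∉ F` is stable under non-zero `F`-multiples. [folklore] -/
theorem mul_not_mem_of_not_mem {F : Subfield Ω} {ϑ w : Ω} (hϑF : ϑ ∉ F) (hwF : w ∈ F)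
    (hw0 : w ≠ 0) : ϑ * w ∉ F := fun h =>
  hϑF (by rw [← mul_div_cancel_right₀ ϑ hw0]; exact div_mem h hwF)

/-- **The value of `ϑ - 1` for `ϑ^p = 1 + b` of level below `(p/(p-1))vp`** (Kuhlmann 2010,
proof of Prop. 4.6: "Since `vb < (p/(p-1))vp` … this implies that `vη < 0`. It follows that
`vη^p < vη` … Consequently, `pvη = v(b/C^p)` … `vη = (1/p)vbC^{-p}`", for `ϑ = 1 + Cη`): if
`v(C)^p < v(b) < 1` then `v(ϑ - 1)^p = v(b)`. PROVED directly from the binomial expansion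
`b = δ^p + pδ·(…)`, `δ = ϑ - 1`: if `v(δ)^{p-1} > v(p)` the term `δ^p` dominates; otherwise
`v(δ) ≤ v(C)` and `v(b) ≤ v(C)^p`. [cite: Kuhlmann2010, Section 4.1, proof of Prop. 4.6] -/
theorem valuation_sub_one_pow_eq {p : ℕ} (hp : p.Prime) {C : Ω} (hC : C ^ (p - 1) = -(p : Ω))
    (hp0 : (p : Ω) ≠ 0) {ϑ b : Ω} (hϑ : ϑ ^ p = 1 + b)
    (hb1 : V.valuation b < 1) (hCb : V.valuation C ^ p < V.valuation b) :
    V.valuation (ϑ - 1) ^ p = V.valuation b := by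
  classical
  have hvp0 : 0 < V.valuation (p : Ω) := (Valuation.pos_iff _).mpr hp0
  have hvCp : V.valuation C ^ (p - 1) = V.valuation (p : Ω) := valuation_pow_pred_eq V hC
  have hnatV : ∀ n : ℕ, V.valuation (n : Ω) ≤ 1 := fun n =>
    (V.valuation_le_one_iff _).mpr (natCast_mem V n)
  set δ : Ω := ϑ - 1 with hδ
  -- `v(ϑ) = 1`, `v(δ) ≤ 1`
  have h1b : V.valuation (1 + b) = 1 := by
    rw [Valuation.map_add_eq_of_lt_left _ (by rwa [map_one]), map_one]
  have hvϑ : V.valuation ϑ = 1 := by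
    have h := congrArg V.valuation hϑ
    rw [map_pow, h1b] at h
    rcases lt_trichotomy (V.valuation ϑ) 1 with hlt | heq | hgt
    · exact absurd h (pow_lt_one₀ zero_le hlt hp.ne_zero).ne
    · exact heq
    · exact absurd h (one_lt_pow₀ hgt hp.ne_zero).ne'
  have hvδ : V.valuation δ ≤ 1 := Valuation.map_sub_le _ hvϑ.le (le_of_eq (map_one _))
  -- the expansion `b = δ^p + p δ S`
  set S : Ω := ∑ k ∈ Finset.Ioo 0 p,
    δ ^ (k - 1) * (1 : Ω) ^ (p - k - 1) * ((p.choose k / p : ℕ) : Ω) with hS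
  have hexp : b = δ ^ p + p * δ * S := by
    have h := add_pow_prime_eq hp δ 1
    rw [one_pow, mul_one, show δ + 1 = ϑ by rw [hδ]; ring, hϑ] at h
    linear_combination h
  have hS1 : V.valuation S ≤ 1 := by
    refine Valuation.map_sum_le _ fun k _ => ?_
    rw [one_pow, mul_one, map_mul, map_pow]
    exact mul_le_one' (pow_le_one₀ zero_le hvδ) (hnatV _)
  have hrest : V.valuation (p * δ * S) ≤ V.valuation (p : Ω) * V.valuation δ := by
    rw [map_mul, map_mul]
    calc V.valuation (p : Ω) * V.valuation δ * V.valuation S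
        ≤ V.valuation (p : Ω) * V.valuation δ * 1 := mul_le_mul_right hS1 _
      _ = V.valuation (p : Ω) * V.valuation δ := mul_one _
  by_cases hcase : V.valuation (p : Ω) < V.valuation δ ^ (p - 1)
  · -- `δ^p` dominates
    have hδ0 : V.valuation δ ≠ 0 := by
      intro h0
      rw [h0, zero_pow (Nat.sub_ne_zero_of_lt hp.one_lt)] at hcase
      exact not_lt_zero hcase
    have hlt : V.valuation (p * δ * S) < V.valuation (δ ^ p) := by
      refine lt_of_le_of_lt hrest ?_
      rw [map_pow]
      calc V.valuation (p : Ω) * V.valuation δ < V.valuation δ ^ (p - 1) * V.valuation δ :=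
            mul_lt_mul_of_pos_right hcase (zero_lt_iff.mpr hδ0)
        _ = V.valuation δ ^ p := by
            rw [← pow_succ, Nat.sub_add_cancel hp.one_le]
    rw [hexp, Valuation.map_add_eq_of_lt_left _ hlt, map_pow]
  · -- otherwise `v(δ) ≤ v(C)` and `v(b) ≤ v(C)^p`, a contradiction
    exfalso
    push Not at hcase
    have hδC : V.valuation δ ≤ V.valuation C := by
      by_contra h
      push Not at h
      have : V.valuation C ^ (p - 1) < V.valuation δ ^ (p - 1) :=
        pow_lt_pow_left₀ h zero_le (Nat.sub_ne_zero_of_lt hp.one_lt)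
      rw [hvCp] at this
      exact not_lt.mpr hcase this
    have hb : V.valuation b ≤ V.valuation C ^ p := by
      rw [hexp]
      refine Valuation.map_add_le _ ?_ ?_
      · rw [map_pow]
        exact pow_le_pow_left₀ zero_le hδC p
      · refine hrest.trans ?_
        rw [valuation_C_pow V hp hC]
        exact mul_le_mul_right hδC _
    exact not_lt.mpr hb hCb

end Generic

/-! ### Radicands over `F = K(x)^h` -/

section Kummer

variable [IsAlgClosed Ω] {p : ℕ} [hp : Fact p.Prime] {K : Subfield Ω} (hK : IsAlgClosed K)
  {x : Ω} (hx : IsValueTranscendentalOver V K x) (hr : IsRankOneValued V (henselizedAdjoin V K x))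
  {C : Ω} (hCK : C ∈ K) (hC : C ^ (p - 1) = -(p : Ω)) (hp0 : (p : Ω) ≠ 0)
  (hvp : V.valuation (p : Ω) < 1)
include hK hx hr hCK hC hp0 hvp

omit hK hr in
/-- **A GOOD radicand which is not a `p`-th power has level below `(p/(p-1))vp`**:
for `b ∈ K(x)^h` with `v(b) = v(c x^j)`, `c ∈ K^×`, `p ∤ j`, and `1 + b ∉ (K(x)^h)^p`,
`v(C)^p < v(b)` — by Lemma 2.10 (`v(b) < v(C)^p` would make `1 + b` a `p`-th power) and since
`v(b) = v(C^p)` would force `j = 0`. [cite: Kuhlmann2010, Section 4.1, proof of Prop. 4.6] -/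
theorem valuation_C_pow_lt_of_good {b : Ω} (hbF : b ∈ henselizedAdjoin V K x)
    (hnot : ∀ w ∈ henselizedAdjoin V K x, w ^ p ≠ 1 + b) {c : Ω} (hc : c ∈ K) (hc0 : c ≠ 0)
    {j : ℤ} (hpj : ¬ (p : ℤ) ∣ j) (hbv : V.valuation b = V.valuation (c * x ^ j)) :
    V.valuation C ^ p < V.valuation b := by
  have hFh := isHenselianField_henselizedAdjoin (V := V)
    Kuhlmann2010HenselizationIsHenselian_holds K x
  have hCF : C ∈ henselizedAdjoin V K x := le_henselizedAdjoin V K x hCK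
  rcases lt_trichotomy (V.valuation b) (V.valuation C ^ p) with hlt | heq | hgt
  · exfalso
    obtain ⟨w, hwF, hw⟩ :=
      exists_pow_eq_one_add_of_valuation_lt V hFh hp.out hCF hC hp0 hvp hbF hlt
    exact hnot w hwF hw
  · exfalso
    have h1 : V.valuation (c * x ^ j) = V.valuation (C ^ p * x ^ (0 : ℤ)) := by
      rw [← hbv, heq, zpow_zero, mul_one, map_pow]
    have hj : j = 0 := hx.eq_of_valuation_mul_zpow_eq hc (pow_mem hCK p) hc0 h1
    exact hpj ⟨0, by rw [hj, mul_zero]⟩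
  · exact hgt

/-- **A radicand of level `> vp` may be taken to be a finite Laurent series without constant
term, all of whose monomials have level `> vp`** (Kuhlmann 2010, proof of Prop. 4.6: "By
Lemma 4.4 and part a) of Corollary 2.11, we may assume that `u = 1 + ∑_{i∈I} cᵢxⁱ ∈ R` …
Since `K` is closed under `p`-th roots, `1+c₀` is a `p`-th power in `K`. We may thus replace `u`
by `u/(1+c₀)`"): for `ϑ^p = 1 + b`, `b ∈ F = K(x)^h`, `v(b) < v(p)`, there are `w ∈ F^×` and
`ℓ : ℤ →₀ K` with `(ϑw)^p = 1 + ∑ ℓᵢxⁱ`, `0 ∉ supp ℓ`, `v(ℓᵢxⁱ) < v(p)` on the support. PROVED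
(Lemma 4.4 = `exists_mem_span_valuation_sub_lt`, Lemma 2.10).
[cite: Kuhlmann2010, Section 4.1, proof of Prop. 4.6] -/
theorem exists_laurent_radicand {ϑ b : Ω} (hbF : b ∈ henselizedAdjoin V K x)
    (hb : V.valuation b < V.valuation (p : Ω)) (hϑ : ϑ ^ p = 1 + b) :
    ∃ w ∈ henselizedAdjoin V K x, w ≠ 0 ∧ ∃ ℓ : ℤ →₀ K,
      (ϑ * w) ^ p = 1 + (ℓ.sum fun i a => (a : Ω) * x ^ i) ∧ 0 ∉ ℓ.support ∧
      ∀ k ∈ ℓ.support, V.valuation ((ℓ k : Ω) * x ^ k) < V.valuation (p : Ω) := by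
  classical
  haveI := hK
  set F := henselizedAdjoin V K x with hFdef
  have hFh : IsHenselianField F (V.comap (algebraMap F Ω)) :=
    isHenselianField_henselizedAdjoin (V := V) Kuhlmann2010HenselizationIsHenselian_holds K x
  have hKF : K ≤ F := le_henselizedAdjoin V K x
  have hxF : x ∈ F := mem_henselizedAdjoin_self V K x
  have hCF : C ∈ F := hKF hCK
  have hC0 : C ≠ 0 := C_ne_zero hp.out hC hp0
  have hvC0 : 0 < V.valuation C := (Valuation.pos_iff _).mpr hC0
  have hvC1 : V.valuation C < 1 := valuation_C_lt_one V hC hvp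
  have hvCp : V.valuation C ^ p < V.valuation (p : Ω) :=
    valuation_C_pow_lt_valuation_p V hp.out hC hp0 hvp
  have hvp0 : 0 < V.valuation (p : Ω) := (Valuation.pos_iff _).mpr hp0
  ---------------------------------------------------------------- Lemma 4.4: `b = r + (b - r)`
  set d : Ω := C ^ p * C with hd
  have hdF : d ∈ F := mul_mem (pow_mem hCF p) hCF
  have hd0 : d ≠ 0 := mul_ne_zero (pow_ne_zero _ hC0) hC0
  have hvd : V.valuation d < V.valuation C ^ p := by
    rw [hd, map_mul, map_pow]
    calc V.valuation C ^ p * V.valuation C < V.valuation C ^ p * 1 :=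
          mul_lt_mul_of_pos_left hvC1 (pow_pos hvC0 p)
      _ = V.valuation C ^ p := mul_one _
  obtain ⟨r, hrR, hbr⟩ := exists_mem_span_valuation_sub_lt hx hr hbF hdF hd0
  obtain ⟨c₀, rfl⟩ := exists_finsupp_of_mem_span K x hrR
  set r : Ω := c₀.sum fun i a => (a : Ω) * x ^ i with hrdef
  have hrF : r ∈ F := finsuppSum_mem hKF hxF c₀
  have hbr' : V.valuation (b - r) < V.valuation C ^ p := hbr.trans hvd
  have hvr : V.valuation r < V.valuation (p : Ω) := by
    have : r = b - (b - r) := by ring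
    rw [this]
    exact Valuation.map_sub_lt _ hb (hbr'.trans hvCp)
  have hvr1 : V.valuation r < 1 := hvr.trans hvp
  have h1r : V.valuation (1 + r) = 1 := by
    rw [Valuation.map_add_eq_of_lt_left _ (by rwa [map_one]), map_one]
  have h1r0 : (1 + r : Ω) ≠ 0 := fun h => by rw [h, map_zero] at h1r; exact zero_ne_one h1r
  -- Lemma 2.10: `1 + b = (1 + r) w₁^p`
  have hlev : V.valuation ((b - r) / (1 + r)) < V.valuation C ^ p := by
    rwa [map_div₀, h1r, div_one]
  obtain ⟨w₁, hw₁F, hw₁⟩ := exists_pow_eq_one_add_of_valuation_lt V hFh hp.out hCF hC hp0 hvp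
    (div_mem (sub_mem hbF hrF) (add_mem F.one_mem hrF)) hlev
  have hlev1 : V.valuation ((b - r) / (1 + r)) < V.valuation (1 : Ω) := by
    rw [map_one]
    exact hlev.trans (valuation_C_pow_lt_one V hp.out hC hvp)
  have hw₁0 : w₁ ≠ 0 := by
    rintro rfl
    have : V.valuation (1 + (b - r) / (1 + r)) = 1 := by
      rw [Valuation.map_add_eq_of_lt_left _ hlev1, map_one]
    rw [← hw₁, zero_pow hp.out.ne_zero, map_zero] at this
    exact zero_ne_one this
  have hfac : 1 + b = (1 + r) * w₁ ^ p := by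
    rw [hw₁, mul_add, mul_one, mul_div_cancel₀ _ h1r0]
    ring
  ---------------------------------------------------------------- remove the constant term
  have hv00 : V.valuation ((c₀ 0 : K) : Ω) < V.valuation (p : Ω) := by
    by_cases h0 : (0 : ℤ) ∈ c₀.support
    · have := valuation_monomial_le_finsuppSum V hx h0
      rw [zpow_zero, mul_one] at this
      exact this.trans_lt hvr
    · rw [Finsupp.notMem_support_iff.mp h0, ZeroMemClass.coe_zero, map_zero]
      exact hvp0
  have hv001 : V.valuation ((c₀ 0 : K) : Ω) < 1 := hv00.trans hvp
  have h1c : V.valuation (1 + ((c₀ 0 : K) : Ω)) = 1 := by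
    rw [Valuation.map_add_eq_of_lt_left _ (by rwa [map_one]), map_one]
  have h1c0 : (1 + c₀ 0 : K) ≠ 0 := by
    intro h
    have h' : (1 : Ω) + ((c₀ 0 : K) : Ω) = 0 := by
      have := congrArg (fun z : K => (z : Ω)) h
      simpa using this
    rw [h', map_zero] at h1c
    exact zero_ne_one h1c
  obtain ⟨κ, hκ⟩ := IsAlgClosed.exists_pow_nat_eq (1 + c₀ 0 : K) hp.out.pos
  have hκ' : ((κ : K) : Ω) ^ p = 1 + ((c₀ 0 : K) : Ω) := by
    have := congrArg (fun z : K => (z : Ω)) hκ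
    simpa using this
  have hκ0 : (κ : Ω) ≠ 0 := by
    intro h
    apply h1c0
    rw [← hκ]
    exact pow_eq_zero_iff hp.out.ne_zero |>.mpr (Subtype.ext h)
  set e : K := (1 + c₀ 0)⁻¹ with he
  have he1 : V.valuation ((e : K) : Ω) = 1 := by
    rw [he, Subfield.coe_inv, map_inv₀]
    push_cast
    rw [h1c, inv_one]
  set ℓ : ℤ →₀ K := (c₀.erase 0).mapRange (fun a => a * e) (zero_mul e) with hℓ
  have hℓeval : (ℓ.sum fun i a => (a : Ω) * x ^ i) =
      ((e : K) : Ω) * (c₀.erase 0).sum fun i a => (a : Ω) * x ^ i := by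
    rw [hℓ, Finsupp.sum_mapRange_index (fun i => by rw [ZeroMemClass.coe_zero]; exact zero_mul _),
      Finsupp.mul_sum]
    refine Finsupp.sum_congr fun i _ => ?_
    push_cast
    ring
  have hrsplit : r = ((c₀ 0 : K) : Ω) + (c₀.erase 0).sum fun i a => (a : Ω) * x ^ i := by
    rw [hrdef]
    conv_lhs => rw [← Finsupp.single_add_erase 0 c₀]
    rw [finsuppSum_add, finsuppSum_single, zpow_zero, mul_one]
  have hfac2 : 1 + r = (κ : Ω) ^ p * (1 + ℓ.sum fun i a => (a : Ω) * x ^ i) := by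
    rw [hκ', hℓeval, hrsplit, he, Subfield.coe_inv]
    push_cast
    have : (1 : Ω) + ((c₀ 0 : K) : Ω) ≠ 0 := fun h => by rw [h, map_zero] at h1c; exact zero_ne_one h1c
    field_simp
    ring
  ---------------------------------------------------------------- conclusion
  refine ⟨(w₁ * κ)⁻¹, F.inv_mem (mul_mem hw₁F (hKF κ.2)), inv_ne_zero (mul_ne_zero hw₁0 hκ0),
    ℓ, ?_, ?_, ?_⟩
  · rw [mul_pow, hϑ, hfac, hfac2, inv_pow, mul_pow]
    field_simp
  · intro h0
    have := Finsupp.support_mapRange h0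
    rw [Finsupp.support_erase] at this
    exact Finset.notMem_erase 0 _ this
  · intro k hk
    have hk' : k ∈ (c₀.erase 0).support := Finsupp.support_mapRange hk
    rw [Finsupp.support_erase] at hk'
    obtain ⟨hk0, hkc⟩ := Finset.mem_erase.mp hk'
    have hcoef : ((ℓ k : K) : Ω) = ((c₀ k : K) : Ω) * ((e : K) : Ω) := by
      rw [hℓ, Finsupp.mapRange_apply, Finsupp.erase_ne hk0, Subfield.coe_mul]
    rw [hcoef, mul_right_comm, map_mul, he1, mul_one]
    exact (valuation_monomial_le_finsuppSum V hx hkc).trans_lt hvr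

omit hr in
/-- **The cascade** (Kuhlmann 2010, proof of Prop. 4.6: "part d) of Corollary 2.11 shows that
we may replace every monomial of the form `cᵢxⁱ` with `i ∈ pℤ` by the monomial `-p c̃ᵢ x^{i/p}`
where `c̃ᵢ ∈ K` is a `p`-th root of `cᵢ` … After an iterated application we may then assume in
addition that `I ∩ pℤ = ∅`. … `I ≠ ∅` because the extension `E|F` is assumed to be
non-trivial. Hence there is some `j ∈ I` such that `v∑_{i∈I} cᵢxⁱ = vc_jx^j`. We have that
`j ∉ pℤ`"): for `ϑ ∉ F = K(x)^h` with `ϑ^p = 1 + ∑ ℓᵢxⁱ`, `0 ∉ supp ℓ`, all `v(ℓᵢxⁱ) < v(p)`,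
some `F^×`-multiple `ϑw` has a GOOD radicand (of level `> vp`). PROVED by induction on `∑_{i ∈ supp ℓ} ν_p(i)`,
each step being Cor. 2.11 d) (`exists_sub_mul_eq_mul_pow`).
[cite: Kuhlmann2010, Section 4.1, proof of Prop. 4.6] -/
theorem exists_good_radicand_of_laurent (n : ℕ) :
    ∀ (ℓ : ℤ →₀ K) (ϑ : Ω), (∑ k ∈ ℓ.support, padicValInt p k) = n → 0 ∉ ℓ.support →
      (∀ k ∈ ℓ.support, V.valuation ((ℓ k : Ω) * x ^ k) < V.valuation (p : Ω)) →
      ϑ ∉ henselizedAdjoin V K x → ϑ ^ p = 1 + (ℓ.sum fun i a => (a : Ω) * x ^ i) →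
      ∃ w ∈ henselizedAdjoin V K x, w ≠ 0 ∧ ∃ b' ∈ henselizedAdjoin V K x,
        (ϑ * w) ^ p = 1 + b' ∧ V.valuation b' < V.valuation (p : Ω) ∧
        ∃ c ∈ K, c ≠ 0 ∧ ∃ j : ℤ, ¬ (p : ℤ) ∣ j ∧ V.valuation b' = V.valuation (c * x ^ j) := by
  classical
  haveI := hK
  set F := henselizedAdjoin V K x with hFdef
  have hFh : IsHenselianField F (V.comap (algebraMap F Ω)) :=
    isHenselianField_henselizedAdjoin (V := V) Kuhlmann2010HenselizationIsHenselian_holds K x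
  have hKF : K ≤ F := le_henselizedAdjoin V K x
  have hxF : x ∈ F := mem_henselizedAdjoin_self V K x
  have hCF : C ∈ F := hKF hCK
  have hvp0 : 0 < V.valuation (p : Ω) := (Valuation.pos_iff _).mpr hp0
  induction n using Nat.strong_induction_on with
  | _ n ih =>
  intro ℓ ϑ hn h0 hval hϑF hϑ
  by_cases hD : ∃ i ∈ ℓ.support, (p : ℤ) ∣ i
  · ---------------------------------------------------------------- one step of Cor. 2.11 d)
    obtain ⟨i, hi, hpi⟩ := hD
    have hi0 : i ≠ 0 := fun h => h0 (h ▸ hi)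
    have hip0 : i / p ≠ 0 := fun h => hi0 (by rw [← Int.ediv_mul_cancel hpi, h, zero_mul])
    -- `c = ρ x^{i/p}` with `ρ^p = ℓ i`
    obtain ⟨ρ, hρ⟩ := IsAlgClosed.exists_pow_nat_eq (ℓ i) hp.out.pos
    have hρ' : ((ρ : K) : Ω) ^ p = ((ℓ i : K) : Ω) := by
      have := congrArg (fun z : K => (z : Ω)) hρ
      simpa using this
    set c : Ω := (ρ : Ω) * x ^ (i / p) with hcdef
    have hcF : c ∈ F := mul_mem (hKF ρ.2) (zpow_mem hxF _)
    have hcp : c ^ p = ((ℓ i : K) : Ω) * x ^ i := by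
      rw [hcdef, mul_pow, hρ', ← zpow_natCast (x ^ (i / p)), ← zpow_mul, Int.ediv_mul_cancel hpi]
    have hvcp : V.valuation c ^ p < V.valuation (p : Ω) := by
      rw [← map_pow, hcp]
      exact hval i hi
    have hvc1 : V.valuation c < 1 :=
      lt_of_pow_lt_pow_left₀ p zero_le (by rw [one_pow]; exact hvcp.trans hvp)
    -- the remaining monomials
    set b₁ : Ω := (ℓ.erase i).sum fun k a => (a : Ω) * x ^ k with hb₁
    have hb₁F : b₁ ∈ F := finsuppSum_mem hKF hxF _
    have hsplit : (ℓ.sum fun k a => (a : Ω) * x ^ k) = c ^ p + b₁ := by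
      rw [finsuppSum_eq_add_sum_erase hi, hcp]
    have herase : ∀ k ∈ (ℓ.erase i).support,
        V.valuation (((ℓ.erase i) k : K) * x ^ k : Ω) < V.valuation (p : Ω) := by
      intro k hk
      rw [Finsupp.support_erase] at hk
      obtain ⟨hki, hkℓ⟩ := Finset.mem_erase.mp hk
      rw [Finsupp.erase_ne hki]
      exact hval k hkℓ
    have hb₁v : V.valuation b₁ ≤ V.valuation C :=
      (valuation_finsuppSum_le V fun k hk => (herase k hk).le).trans
        (valuation_p_le_valuation_C V hp.out hC hvp)
    -- Cor. 2.11 d): `1 + b₁ - pc = (1 + b₁ + c^p) w^p`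
    obtain ⟨w, hwF, hw0, hw⟩ :=
      exists_sub_mul_eq_mul_pow V hFh hp.out hCF hC hp0 hvp hb₁F hcF hb₁v hvcp
    -- the new Laurent data
    set ℓ' : ℤ →₀ K := ℓ.erase i + Finsupp.single (i / p) (-(p : K) * ρ) with hℓ'def
    have heval' : (ℓ'.sum fun k a => (a : Ω) * x ^ k) = b₁ - p * c := by
      rw [hℓ'def, finsuppSum_add, finsuppSum_single, hcdef]
      push_cast
      ring
    have hϑ' : (ϑ * w) ^ p = 1 + (ℓ'.sum fun k a => (a : Ω) * x ^ k) := by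
      rw [heval', mul_pow, hϑ, hsplit, show (1 : Ω) + (c ^ p + b₁) = 1 + b₁ + c ^ p by ring, ← hw]
      ring
    have hsupp' : ℓ'.support ⊆ insert (i / p) (ℓ.support.erase i) := by
      intro k hk
      rw [hℓ'def] at hk
      have h1 := Finsupp.support_add hk
      rw [Finset.mem_union, Finsupp.support_erase] at h1
      rcases h1 with h1 | h1
      · exact Finset.mem_insert_of_mem h1
      · have h2 := Finsupp.support_single_subset h1
        rw [Finset.mem_singleton] at h2
        rw [h2]
        exact Finset.mem_insert_self _ _
    have h0' : (0 : ℤ) ∉ ℓ'.support := by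
      intro hk
      have h1 := hsupp' hk
      rw [Finset.mem_insert, Finset.mem_erase] at h1
      rcases h1 with h1 | ⟨-, h1⟩
      · exact hip0 h1.symm
      · exact h0 h1
    have hval' : ∀ k ∈ ℓ'.support, V.valuation ((ℓ' k : Ω) * x ^ k) < V.valuation (p : Ω) := by
      intro k _
      have hcoef : ((ℓ' k : K) : Ω) =
          (((ℓ.erase i) k : K) : Ω) + ((Finsupp.single (i / p) (-(p : K) * ρ) k : K) : Ω) := by
        rw [hℓ'def, Finsupp.add_apply, Subfield.coe_add]
      rw [hcoef, add_mul]
      refine Valuation.map_add_lt _ ?_ ?_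
      · by_cases hk : k ∈ (ℓ.erase i).support
        · exact herase k hk
        · rw [Finsupp.notMem_support_iff.mp hk, ZeroMemClass.coe_zero, zero_mul, map_zero]
          exact hvp0
      · by_cases hk2 : k = i / p
        · rw [hk2, Finsupp.single_eq_same]
          push_cast
          rw [show -(p : Ω) * (ρ : Ω) * x ^ (i / p) = -((p : Ω) * c) by rw [hcdef]; ring,
            Valuation.map_neg, map_mul]
          calc V.valuation (p : Ω) * V.valuation c < V.valuation (p : Ω) * 1 :=
                mul_lt_mul_of_pos_left hvc1 hvp0
            _ = V.valuation (p : Ω) := mul_one _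
        · rw [Finsupp.single_eq_of_ne hk2, ZeroMemClass.coe_zero, zero_mul, map_zero]
          exact hvp0
    -- the measure decreases: `ν(i/p) + 1 = ν(i)`
    have hνi : padicValInt p (i / p) + 1 = padicValInt p i := by
      have := padicValInt_mul_eq_succ (p := p) (i / p) hip0
      rw [Int.ediv_mul_cancel hpi] at this
      omega
    have hμ : (∑ k ∈ ℓ'.support, padicValInt p k) < n := by
      calc ∑ k ∈ ℓ'.support, padicValInt p k
          ≤ ∑ k ∈ insert (i / p) (ℓ.support.erase i), padicValInt p k :=
            Finset.sum_le_sum_of_subset_of_nonneg hsupp' fun _ _ _ => Nat.zero_le _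
        _ ≤ padicValInt p (i / p) + ∑ k ∈ ℓ.support.erase i, padicValInt p k := by
            by_cases hmem : i / p ∈ ℓ.support.erase i
            · rw [Finset.insert_eq_of_mem hmem]
              exact Nat.le_add_left _ _
            · rw [Finset.sum_insert hmem]
        _ < padicValInt p i + ∑ k ∈ ℓ.support.erase i, padicValInt p k := by
            apply Nat.add_lt_add_right
            omega
        _ = ∑ k ∈ ℓ.support, padicValInt p k := Finset.add_sum_erase _ _ hi
        _ = n := hn
    -- induction
    obtain ⟨w', hw'F, hw'0, b', hb'F, hϑ'', hb'v, hgood⟩ :=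
      ih _ hμ ℓ' (ϑ * w) rfl h0' hval' (mul_not_mem_of_not_mem hϑF hwF hw0) hϑ'
    exact ⟨w * w', mul_mem hwF hw'F, mul_ne_zero hw0 hw'0, b', hb'F,
      by rw [← mul_assoc]; exact hϑ'', hb'v, hgood⟩
  · ---------------------------------------------------------------- end state: `I ∩ pℤ = ∅`
    push Not at hD
    by_cases hℓ : ℓ = 0
    · exfalso
      rw [hℓ, Finsupp.sum_zero_index, add_zero] at hϑ
      exact hϑF (hKF (mem_of_pow_eq_one_of_isAlgClosed hK hp.out.ne_zero hϑ))
    · obtain ⟨j, hj, hval_eq, -⟩ := exists_valuation_finsupp_sum_eq hx hℓ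
      exact ⟨1, F.one_mem, one_ne_zero, _, finsuppSum_mem hKF hxF ℓ, by rw [mul_one]; exact hϑ,
        valuation_finsuppSum_lt V hvp0.ne' hval,
        (ℓ j : Ω), (ℓ j).2, coe_finsupp_ne_zero hj, j, hD j hj, hval_eq⟩

end Kummer

end Literature.AlgebraicGeometry.Resolution
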